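import Summits.AtomisticToContinuum.HydrodynamicLimit.Theorems.CollisionIsometryCLTMacroClosureBarycentricDefs
import Summits.AtomisticToContinuum.HydrodynamicLimit.Theorems.CollisionIsometryCLTMacroClosureStubClausiusDV
import Summits.AtomisticToContinuum.HydrodynamicLimit.Theorems.DenseExcursion.Negative.AtTimeZero
import HarnessLib

/-!
# Stub `stub_clausius` of the line `IdeatorTwoGen1Sketch` (crux `MacroClosure`, stmt-14870), part 2:
# the `t = 0` tie pins the classical data to the local Gibbs profiles

Support file (`--supports stmt-AtomisticToContinuum-14870`) for the registered stub
`Barycentric.stub_clausius`; it lands the registered sub-goal `stub_clausius_identify`.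

For continuous profiles `a₀, θ₀ > 0`, `u₀` there is `σ₂ ≤ 1/2` such that for `σ < σ₂`, every classical
hs-Euler solution `(ρ, u, θ)` on `[0,T)`, `T > 0`, whose `t = 0` fields are the in-probability limit of the
local Gibbs laws `localGibbsLaw σ a₀ u₀ θ₀` (`TendstoHydroFieldsAt … 0`) satisfies
`u 0 = u₀`, `θ 0 = θ₀`, `ρ(0,x) σ³ ≤ 1`, `∫ ρ 0 = 1`, and the flow-free density law of large numbers with
profile `ρ 0` (the hypothesis format of `InitialEntropyValue`). Proof: the tree's PROVED law of large
numbers `localGibbs_lln_holds` gives a second in-probability limit `(ρ₀, ρ₀u₀, E(ρ₀,u₀,θ₀))` of the same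
fields under the same laws; limits in probability are unique
(`DenseExcursionAtTimeZero.eq_of_tendsto_measure_lt_abs`, `Clausius.eq_of_tendsto_measure_norm_sub`) and
continuous functions are determined by continuous test functions
(`DenseExcursionAtTimeZero.eq_of_forall_integral_mul_eq`), so `ρ 0 = ρ₀`, `ρ₀ u 0 = ρ₀ u₀`,
`E(ρ₀,u 0,θ 0) = E(ρ₀,u₀,θ₀)`, whence `u 0 = u₀`, `θ 0 = θ₀` (`ρ₀ > 0`); the packing bound is the pinning
`ρ 0 = rhoLim (profileOf a₀) σ < (2e+1)M` of `DenseExcursionAtTimeZero.density_zero_eq_rhoLim`,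
`rhoLim_lt`, for `σ ≤ 1/((2e+1)M)`.
-/

noncomputable section

open MeasureTheory Filter Set Topology InformationTheory
open scoped ENNReal ContDiff

namespace Summit.AtomisticToContinuum.HydrodynamicLimit.Theorems.MacroClosureLine

open Literature.MathematicalPhysics.KineticTheory Literature.Analysis.FluidPDE
open Literature.Analysis.FunctionSpaces

namespace Barycentric

namespace Clausius

/-- Events tested through `Φ_0` have the same local Gibbs probability as the untransported events
(`Φ_0 = id` almost surely). [folklore] -/
theorem localGibbsLaw_setOf_flow_zero {σ : ℝ} (a₀ : T3 → ℝ) (u₀ : T3 → V3) (θ₀ : T3 → ℝ) (N : ℕ)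
    (Φ : Flow σ N) (p : Config (N + 1) (Fin 3) T3 → Prop) :
    localGibbsLaw σ a₀ u₀ θ₀ N Φ {z | p (Φ.flow 0 z)} = localGibbsLaw σ a₀ u₀ θ₀ N Φ {z | p z} := by
  have h := localGibbsLaw_preimage_flow_zero σ a₀ u₀ θ₀ N Φ {z | p z}
  rw [← localGibbsLaw_eq σ a₀ u₀ θ₀ N Φ] at h
  exact h

/-- The total energy density is continuous in its three arguments along continuous fields. [folklore] -/
theorem continuous_totalEnergyDensity_comp {r t : T3 → ℝ} {v : T3 → V3} (hr : Continuous r)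
    (hv : Continuous v) (ht : Continuous t) :
    Continuous fun x => totalEnergyDensity (r x) (v x) (t x) := by
  unfold totalEnergyDensity
  fun_prop

/-- A coordinate of a `V3`-valued integral of a continuous integrand on `𝕋³`. [folklore] -/
theorem integral_smul_apply {g : T3 → ℝ} {v : T3 → V3} (hg : Continuous g) (hv : Continuous v)
    (l : Fin 3) : (∫ x, g x • v x) l = ∫ x, g x * v x l := by
  have hint : Integrable (fun x => g x • v x) := integrable_of_continuous_T3 (hg.smul hv)
  rw [show (∫ x, g x • v x) l = (EuclideanSpace.proj l : V3 →L[ℝ] ℝ) (∫ x, g x • v x) from rfl,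
    ← ContinuousLinearMap.integral_comp_comm _ hint]
  refine integral_congr_ae (Eventually.of_forall fun x => ?_)
  simp only [EuclideanSpace.coe_proj, PiLp.smul_apply, smul_eq_mul]

/-- **The `t = 0` tie pins the classical data.** See the module docstring. [folklore] -/
theorem identify (a₀ θ₀ : T3 → ℝ) (u₀ : T3 → V3) (ha : Continuous a₀) (hθ : Continuous θ₀)
    (hu : Continuous u₀) (ha0 : ∀ x, 0 < a₀ x) (hθ0 : ∀ x, 0 < θ₀ x) :
    ∃ σ₂ : ℝ, 0 < σ₂ ∧ σ₂ ≤ 1 / 2 ∧ ∀ σ : ℝ, 0 < σ → σ < σ₂ →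
      ∀ (T : ℝ) (ρ θ : ℝ → T3 → ℝ) (u : ℝ → T3 → V3), IsHardSphereEulerSolution σ T ρ u θ → 0 < T →
      ∀ Φ : (N : ℕ) → Flow σ N,
        TendstoHydroFieldsAt (fun N => localGibbsLaw σ a₀ u₀ θ₀ N (Φ N)) Φ ρ u θ 0 →
        u 0 = u₀ ∧ θ 0 = θ₀ ∧ (∀ x, ρ 0 x * σ ^ 3 ≤ 1) ∧ ∫ x, ρ 0 x = 1 ∧
        ∀ χ : T3 → ℝ, Continuous χ → ∀ δ : ℝ, 0 < δ →
          Tendsto (fun N => localGibbsLaw σ a₀ u₀ θ₀ N (Φ N)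
            {z | δ < |empiricalDensityField z χ - ∫ x, χ x * ρ 0 x|}) atTop (𝓝 0) := by
  obtain ⟨σL, hσL, HL⟩ := localGibbs_lln_holds a₀ θ₀ u₀ ha hθ hu ha0 hθ0
  obtain ⟨σ₁, hσ₁, hσ₁2, H1⟩ := DenseExcursionAtTimeZero.density_zero_eq_rhoLim ha hθ hu ha0 hθ0
  set Pf := profileOf a₀ ha ha0 with hPf
  set K : ℝ := (2 * Real.exp 1 + 1) * Pf.M with hK
  have hK0 : 0 < K := by have := Pf.M_pos; positivity
  refine ⟨min σL (min σ₁ (min 1 (1 / K))), lt_min hσL (lt_min hσ₁ (lt_min one_pos (by positivity))),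
    (min_le_right _ _).trans ((min_le_left _ _).trans hσ₁2), fun σ hσ hσlt => ?_⟩
  have hσL' : σ < σL := lt_of_lt_of_le hσlt (min_le_left _ _)
  have hσ1 : σ < σ₁ := lt_of_lt_of_le hσlt ((min_le_right _ _).trans (min_le_left _ _))
  have hσone : σ < 1 :=
    lt_of_lt_of_le hσlt ((min_le_right _ _).trans ((min_le_right _ _).trans (min_le_left _ _)))
  have hσK : σ < 1 / K :=
    lt_of_lt_of_le hσlt ((min_le_right _ _).trans ((min_le_right _ _).trans (min_le_right _ _)))
  intro T ρ θ u hE hT0 Φ hT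
  have h0 : (0 : ℝ) ∈ Ico 0 T := ⟨le_rfl, hT0⟩
  have hρc : Continuous (ρ 0) := (hE.smooth_density.isSmooth_slice h0).continuous
  have huc : Continuous (u 0) := (hE.smooth_velocity.isSmooth_slice h0).continuous
  have hθc : Continuous (θ 0) := (hE.smooth_temperature.isSmooth_slice h0).continuous
  have hρpos : ∀ x, 0 < ρ 0 x := hE.density_pos 0 h0
  obtain ⟨hS, H1'⟩ := H1 σ hσ hσ1
  have hρlim : ρ 0 = rhoLim Pf σ := H1' ρ θ u Φ hρc hT
  obtain ⟨ρ₀, hρ₀c, -, HΦ⟩ := HL σ hσ hσL'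
  obtain ⟨hprob, hLLN⟩ := HΦ Φ
  haveI : ∀ N, IsProbabilityMeasure (localGibbsLaw σ a₀ u₀ θ₀ N (Φ N)) := hprob
  set P : (N : ℕ) → Measure (Config (N + 1) (Fin 3) T3) := fun N => localGibbsLaw σ a₀ u₀ θ₀ N (Φ N)
    with hPdef
  have hPev : ∀ᶠ N in atTop, IsProbabilityMeasure (P N) := Eventually.of_forall hprob
  -- density: `ρ 0 = ρ₀`
  have hρρ₀ : ρ 0 = ρ₀ := by
    refine DenseExcursionAtTimeZero.eq_of_forall_integral_mul_eq hρc hρ₀c fun χ hχ => ?_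
    exact DenseExcursionAtTimeZero.eq_of_tendsto_measure_lt_abs (P := P)
      (F := fun N z => empiricalDensityField ((Φ N).flow 0 z) χ) hPev
      (fun δ hδ => (hT χ hχ δ hδ).1) (fun δ hδ => (hLLN χ hχ δ hδ).1)
  -- momentum: `ρ 0 • u 0 = ρ 0 • u₀`, hence `u 0 = u₀`
  have hmom : ∀ χ : T3 → ℝ, Continuous χ →
      (∫ x, (χ x * ρ 0 x) • u 0 x) = ∫ x, (χ x * ρ 0 x) • u₀ x := by
    intro χ hχ
    have h := Clausius.eq_of_tendsto_measure_norm_sub P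
      (fun N z => empiricalMomentumField ((Φ N).flow 0 z) χ)
      (fun δ hδ => (hT χ hχ δ hδ).2.1) (fun δ hδ => (hLLN χ hχ δ hδ).2.1)
    rw [h, hρρ₀]
  have huu : u 0 = u₀ := by
    have hcoord : ∀ l : Fin 3, (fun x => ρ 0 x * u 0 x l) = fun x => ρ 0 x * u₀ x l := by
      intro l
      refine DenseExcursionAtTimeZero.eq_of_forall_integral_mul_eq (hρc.mul (by fun_prop))
        (hρc.mul (by fun_prop)) fun χ hχ => ?_
      have h := congrArg (fun v : V3 => v l) (hmom χ hχ)
      simp only at h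
      rw [integral_smul_apply (g := fun x => χ x * ρ 0 x) (hχ.mul hρc) huc,
        integral_smul_apply (g := fun x => χ x * ρ 0 x) (hχ.mul hρc) hu] at h
      calc ∫ x, χ x * (ρ 0 x * u 0 x l) = ∫ x, χ x * ρ 0 x * u 0 x l :=
            integral_congr_ae (Eventually.of_forall fun x => by simp only; ring)
        _ = ∫ x, χ x * ρ 0 x * u₀ x l := h
        _ = ∫ x, χ x * (ρ 0 x * u₀ x l) :=
            integral_congr_ae (Eventually.of_forall fun x => by simp only; ring)
    funext x
    ext l
    have h := congr_fun (hcoord l) x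
    exact mul_left_cancel₀ (hρpos x).ne' h
  -- energy: `E(ρ 0, u 0, θ 0) = E(ρ 0, u₀, θ₀)`, hence `θ 0 = θ₀`
  have hener : (fun x => totalEnergyDensity (ρ 0 x) (u 0 x) (θ 0 x)) =
      fun x => totalEnergyDensity (ρ 0 x) (u₀ x) (θ₀ x) := by
    refine DenseExcursionAtTimeZero.eq_of_forall_integral_mul_eq
      (continuous_totalEnergyDensity_comp hρc huc hθc)
      (continuous_totalEnergyDensity_comp hρc hu hθ) fun χ hχ => ?_
    have h := DenseExcursionAtTimeZero.eq_of_tendsto_measure_lt_abs (P := P)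
      (F := fun N z => empiricalEnergyField ((Φ N).flow 0 z) χ) hPev
      (fun δ hδ => (hT χ hχ δ hδ).2.2) (fun δ hδ => (hLLN χ hχ δ hδ).2.2)
    rw [h, hρρ₀]
  have hθθ : θ 0 = θ₀ := by
    funext x
    have h := congr_fun hener x
    simp only [totalEnergyDensity, huu] at h
    have hρx := hρpos x
    nlinarith [mul_left_cancel₀ hρx.ne' h]
  -- packing at `t = 0`
  have hpack : ∀ x, ρ 0 x * σ ^ 3 ≤ 1 := by
    intro x
    have hlt : ρ 0 x < K := by rw [hρlim]; exact DenseExcursionAtTimeZero.rhoLim_lt hS x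
    have hσ3 : σ ^ 3 ≤ σ := by
      have e : σ ^ 3 = σ * (σ * σ) := by ring
      rw [e]; exact mul_le_of_le_one_right hσ.le (by nlinarith)
    have : ρ 0 x * σ ^ 3 < 1 :=
      calc ρ 0 x * σ ^ 3 ≤ ρ 0 x * σ := by gcongr; exact (hρpos x).le
        _ < K * (1 / K) := mul_lt_mul'' hlt hσK (hρpos x).le hσ.le
        _ = 1 := mul_one_div_cancel hK0.ne'
    exact this.le
  -- total mass
  have hmass : ∫ x, ρ 0 x = 1 := by
    have h := DenseExcursionAtTimeZero.eq_of_tendsto_measure_lt_abs (P := P)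
      (F := fun N z => empiricalDensityField ((Φ N).flow 0 z) fun _ => (1 : ℝ)) hPev
      (a := ∫ x, (1 : ℝ) * ρ 0 x) (b := 1)
      (fun δ hδ => (hT (fun _ => 1) continuous_const δ hδ).1) (fun δ hδ => ?_)
    · simpa using h
    · refine tendsto_const_nhds.congr fun N => ?_
      have hempty : {z : Config (N + 1) (Fin 3) T3 |
          δ < |empiricalDensityField ((Φ N).flow 0 z) (fun _ => (1 : ℝ)) - 1|} = ∅ := by
        ext z
        simp only [mem_setOf_eq, mem_empty_iff_false, iff_false, not_lt,
          empiricalDensityField_one (Nat.succ_ne_zero N), sub_self, abs_zero]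
        exact hδ.le
      simp only [hPdef, hempty, measure_empty]
  refine ⟨huu, hθθ, hpack, hmass, fun χ hχ δ hδ => ?_⟩
  refine (hT χ hχ δ hδ).1.congr fun N => ?_
  exact localGibbsLaw_setOf_flow_zero a₀ u₀ θ₀ N (Φ N)
    (fun w => δ < |empiricalDensityField w χ - ∫ x, χ x * ρ 0 x|)

end Clausius

/-- Registered sub-goal `stub_clausius_identify` of the stub `stub_clausius`: below a threshold
`σ₂(a₀,θ₀,u₀) ≤ 1/2`, every classical hs-Euler solution tied at `t = 0` to the local Gibbs laws
`localGibbsLaw σ a₀ u₀ θ₀` has `u 0 = u₀`, `θ 0 = θ₀`, initial packing `ρ(0,x)σ³ ≤ 1`, unit mass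
`∫ ρ 0 = 1`, and the flow-free density law of large numbers with profile `ρ 0`
(`Clausius.identify`). [folklore] -/
theorem stub_clausius_identify : ∀ (a₀ θ₀ : T3 → ℝ) (u₀ : T3 → V3), Continuous a₀ → Continuous θ₀ → Continuous u₀ → (∀ x, 0 < a₀ x) → (∀ x, 0 < θ₀ x) → ∃ σ₂ : ℝ, 0 < σ₂ ∧ σ₂ ≤ 1 / 2 ∧ ∀ σ : ℝ, 0 < σ → σ < σ₂ → ∀ (T : ℝ) (ρ θ : ℝ → T3 → ℝ) (u : ℝ → T3 → V3), IsHardSphereEulerSolution σ T ρ u θ → 0 < T → ∀ Φ : (N : ℕ) → Flow σ N, TendstoHydroFieldsAt (fun N => localGibbsLaw σ a₀ u₀ θ₀ N (Φ N)) Φ ρ u θ 0 → u 0 = u₀ ∧ θ 0 = θ₀ ∧ (∀ x, ρ 0 x * σ ^ 3 ≤ 1) ∧ ∫ x, ρ 0 x = 1 ∧ ∀ χ : T3 → ℝ, Continuous χ → ∀ δ : ℝ, 0 < δ → Tendsto (fun N => localGibbsLaw σ a₀ u₀ θ₀ N (Φ N) {z | δ < |empiricalDensityField z χ - ∫ x,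 χ x * ρ 0 x|}) atTop (𝓝 0) :=
  Clausius.identify

end Barycentric

end Summit.AtomisticToContinuum.HydrodynamicLimit.Theorems.MacroClosureLine

end
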